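import Mathlib.NumberTheory.Cyclotomic.Basic
import Literature.NumberTheory.EllipticCurves.Kato2004.BigImageDivisibilityCyclotomicThree
import HarnessLib

/-!
# Kato 2004, Thm. 17.4 (3) for an odd prime `p` (big `p`-adic image), read over `K = ℚ(ζ_p)`:
# `char_{Λ(Γ)} X(E/ℚ(ζ_{p^∞})) ∋ u · ∏_{i mod p−1} L_p(E, ω^i, T)` (all `p − 1` branches)

Source: K. Kato, *`p`-adic Hodge theory and values of zeta functions of modular forms*, Astérisque
**295** (2004) 117–290 [Kato2004Asterisque], **Theorem 17.4 (3)** (p. 273), with §17.3 (p. 273: the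
Selmer group `Sel_∞(T) = lim_n Sel(ℚ(ζ_{p^n}), T(r))(−r)` over the full cyclotomic tower and its dual
`X(T)` "as a module over `Λ = O_λ⟦G_∞⟧`"), §12.1 (pp. 219–220: `G_∞ = Gal(ℚ(ζ_{p^∞})/ℚ)`,
`κ : G_∞ ≅ ℤ_p^×`, `Λ = O_λ⟦G_∞⟧`), Thm. 12.5 (4) (p. 222: condition (12.5.2)), §17.5 (p. 274:
"good" `ω`, `γ`) and Thm. 16.2 (p. 269: the `p`-adic zeta function `L_{p-adic,α,ω,γ}(f)` and its
periods). ONE NAMED FACT (`def … : Prop`, nothing asserted, D-0014): Theorem 17.4 (3) for an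
arbitrary odd prime `p`, `f = f_E` of weight `2`, `F_λ = ℚ_p`, `T = T_pE(−1)`, transcribed WITHOUT
any descent — the `p`-general form announced as `TODO(general form)` in the `p = 3` sibling
`charIdeal_dvd_padicLFunction_cyclotomicThree_of_surjective`, and the big-image SIBLING of
`Wuthrich2014.charIdeal_dvd_padicLFunction_cyclotomicPrime` (same module shape, same conclusion).

## The printed statements (held copy `paper:doi-10-24033-ast-639`, OCR-cleaned; pages re-read)

Thm. 17.4 (p. 273): "Assume `f` has good ordinary reduction at `λ`. Let `T` be a
`Gal(ℚ̄/ℚ)`-stable `O_λ`-lattice of `V_{F_λ}(f)`. (1) `X(T)` is a torsion `Λ`-module. (2) Let `α` be as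
in 17.1, let `ω` be a non-zero element of `S(f*)`, and let `γ` be an element of `V_F(f*)` such that
`γ⁺ ≠ 0` and `γ⁻ ≠ 0`. Then `L_{p-adic,α,ω,γ}(f) ∈ Λ ⊗ ℚ`, and we have
`length_{Λ_𝔭}(X(T)_𝔭) ≤ ord_𝔭(L_{p-adic,α,ω,γ}(f))` for any prime ideal `𝔭` in `Λ` of height one
which does not contain `p`. (3) Let `α, ω, γ` be as in (2), and assume that both `ω` and `γ` are good
for some `Gal(ℚ̄/ℚ)`-stable `O_λ`-lattice of `V_{F_λ}(f)` in the sense of 17.5 below. Assume further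
`p ≠ 2` and that the condition 12.5.2 in 12.5 (4) is satisfied. Then `L_{p-adic,α,ω,γ}(f)` belongs to
`Λ` and `length_{Λ_𝔭}(X(T)_𝔭) ≤ ord_𝔭(L_{p-adic,α,ω,γ}(f))` for any prime ideal `𝔭` of `Λ` of height
one." §17.3 (p. 273): "`X(T) = Hom_{O_λ}(Sel_∞(T), F_λ/O_λ)`. We regard `X(T)` as a module over
`Λ = O_λ⟦G_∞⟧`." (12.5.2) (p. 222): "There exists an `O_λ`-basis of `T` for which the image of
`Gal(ℚ̄/ℚ(ζ_{p^∞})) → GL_{O_λ}(T) ≅ GL₂(O_λ)` contains `SL₂(ℤ_p)`." §17.5 (p. 274): "In the case `f`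
of weight `2` and `T = (T_pE)(−1)` for an elliptic curve `E` over `ℚ`, `ω` is good for `T` if and
only if `ω` is a `ℤ_p`-basis of `coLie(𝓔) ⊗ ℤ_p` where `𝓔` is the Néron model of `E`"; (14.18)
"`γ` is good for `T` if `γ⁺` is an `O_λ`-basis of `T⁺` and `γ⁻` is an `O_λ`-basis of `T⁻`."

## The reading — IDENTICAL to that of the `p = 3` sibling (flag `Kato-17.4-p3-branch-split`), with
## `p − 1` components instead of two (Wuthrich 2014 §3 p. 390: "`M = ⊕_{i=0}^{p−2} M_i`")

For `E/ℚ` and `p` odd good ordinary: `F_λ = ℚ_p`, `O_λ = ℤ_p`, `T = T_pE(−1)`, `r = 1`, so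
`Sel(ℚ(ζ_{p^n}), T(1)) = Sel_{p^∞}(E/ℚ(ζ_{p^n}))` (Kato §14.1) and `X(T)` is the Pontryagin dual of
`Sel_{p^∞}(E/ℚ(ζ_{p^∞}))` as a `Λ = ℤ_p⟦G_∞⟧`-module, `G_∞ = Gal(ℚ(ζ_{p^∞})/ℚ) ≅ ℤ_p^× = Δ × Γ`,
`#Δ = p − 1`. **Take `K := ℚ(ζ_p)`**: the fields `ℚ(ζ_{p^{n+1}})` are exactly the layers of the
cyclotomic `ℤ_p`-extension `K_∞ = ℚ(ζ_{p^∞})` of the NUMBER FIELD `K`, so `X(T) = X(E/K_∞)` IS the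
tree's `WeierstrassCurve.SelmerDualData` of (any `K`-model `V'` of) `E_K` for `κ : ZpExtension K p`
cyclotomic, `T = γ − 1`, `χ_p(γ) = 1 + p` (`cyclotomicGenerator p`; tree
`Summit.….exists_isCyclotomic_isTopGenerator_cyclotomicPrime`). `Λ(G_∞) = ⊕_{i=0}^{p−2} Λ(Γ)e_i`
(`p ∤ #Δ`, the Teichmüller character `ω` is `ℤ_p`-valued); the height-one primes of `Λ(G_∞)` are
those of the `p − 1` factors, so "`length_{Λ_𝔭}(X(T)_𝔭) ≤ ord_𝔭(L)` for every height-one `𝔭`" says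
`char_{Λ(Γ)}(e_iX) ∣ e_iL` in `Λ(Γ)` (a UFD) for every `i`, whence — characteristic ideals being
multiplicative over `X = ⊕ e_iX` — `char_{Λ(Γ)} X(E/K_∞) ∋ ∏_i e_iL`. The components `e_iL` of Kato's
`L_{p-adic,α,ω,γ}(f) ∈ Λ(G_∞)` (Thm. 16.2: the measure interpolating
`G(χ,ζ_{p^n}) α^{−n} L(f,χ̄,1)/Ω^{sgn χ}`, `per(ω) = Ω⁺γ⁺ + Ω⁻γ⁻`; for `ω` = Néron differential and
`γ` good, `Ω^±` are the Néron periods of `E` up to `ℤ_p^×` and signs) are the `p − 1` tame branches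
of the Mazur–Swinnerton-Dyer measure: `e_iL ↔ L_p(E,ω^i,T)` on the PLUS modular symbols for `i`
even (tree `padicLFunctionBranch f α i`) and on the MINUS modular symbols for `i` odd
(Mazur–Tate–Teitelbaum 1986 §I.13; tree `padicLFunctionMinusBranch f α i`). Period normalisation
(the only translation made, exactly as in the Wuthrich sibling and in the tree's `kato_divisibility`):
with `ϖ⁺·Ω_E = Ω⁺_f`, `ϖ⁻·|Ω⁻(E)| = Ω⁻_f` (`plusPeriod f`, `minusPeriod f`; `realPeriodRat`,
`imaginaryPeriodRat`), one factor `ϖ⁺` per even branch and one factor `ϖ⁻` per odd branch, the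
Néron-normalised product is `u·(ϖ⁺)^{(p−1)/2}(ϖ⁻)^{(p−1)/2}·∏_{i<p−1} B_i` for a `p`-adic unit `u`
(signs, `c_∞ ∈ {1,2}`, powers of `2`), kept as an explicit unit.

Hypotheses transcribed: `E = V` globally minimal over `ℚ`, good ordinary at `p` (`IsOrdinaryAt V p`,
= 17.1 (i): `p ∤ N`, `a_p ∈ O_λ^×`); `p ≠ 2`; (12.5.2) as "`ρ̄_{E,p^n} : Γ_ℚ → GL₂(ℤ/p^n)` is
surjective for every `n`" (`∀ n, V.HasSurjectiveModNGaloisRep (p^n)` — the tree's spelling of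
"`ρ_{E,p}` onto `GL₂(ℤ_p)`", as in `kato_divisibility` clause 3; it implies (12.5.2) because
`det ρ = χ_p` cuts out `ℚ(ζ_{p^∞})`, so the image of `Gal(ℚ̄/ℚ(ζ_{p^∞}))` is
`ρ(Γ_ℚ) ∩ SL₂(ℤ_p) = SL₂(ℤ_p)`); `ω`, `γ` good (a CHOICE, always possible: 17.5 "Note that a good
`ω` for `T` exists") — absorbed in the period normalisation above; `K` a cyclotomic extension `{p}`
of `ℚ`, `V'` any `K`-model of `E_K`, `κ` the cyclotomic `ℤ_p`-extension of `K` with topological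
generator `γ`, `χ_p(γ)·ζ = 1 + p` with `ζ` torsion, `f` the newform of `E`, `α = unitRoot V p`, `D` a
Pontryagin-dual datum of `Sel_{p^∞}(E/K_∞)`. Conclusion: `X(E/K_∞)` is `Λ`-torsion (17.4 (1)) and
`u (ϖ⁺ϖ⁻)^{(p−1)/2} · ∏_{i<p−1} B_i = ι g` for some `g ∈ char_{Λ(Γ)} X(E/K_∞)`, `u ∈ ℤ_p^×`.

What is NOT here: `p = 2`; (12.5.2) in its printed generality (image CONTAINS `SL₂(ℤ_p)`); modular
forms of weight `k > 2` or with coefficients; any proof (Kato's Euler system is not in Mathlib). No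
`_holds` is to be expected.
-- TODO(general form): Thm. 17.4 (3) for lattices `T ⊂ V_{F_λ}(f)` of any ordinary newform `f` of
-- weight `k ≥ 2` with coefficients, under (12.5.2) "the image contains `SL₂(ℤ_p)`".

Consumer: the BSD rank-≤1 residual cell (`b2b-bsdres`, sub-cell additive-p4, line V19): with
Greenberg's Euler-characteristic formula over `F = ℚ(ζ_p)`, the bottom-layer control finiteness and
the restriction `ℚ(√p*) → ℚ(ζ_p)` this fact bounds `#Ш(E/ℚ)[p^∞] · #Ш(E^{(p*)}/ℚ)[p^∞]` for the
ADDITIVE twist `E^{(p*)}` with `E[p]` IRREDUCIBLE (class X4 at a potentially good ordinary `p ≥ 5`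
with `e = 2`), the `p − 3` non-quadratic branch values entering as explicit per-pair terms.
-/

set_option autoImplicit false

noncomputable section

open scoped Classical MatrixGroups ModularForm

open CongruenceSubgroup WeierstrassCurve Literature.NumberTheory.EllipticCurves
  Literature.NumberTheory.EllipticCurves.ModularForms
  Literature.NumberTheory.GaloisRepresentations

namespace Literature.NumberTheory.EllipticCurves.Kato2004

/-- **Kato 2004, Theorem 17.4 (3) for an odd prime `p` under `ρ_{E,p^∞}` onto, read over
`K = ℚ(ζ_p)`: `char_{Λ(Γ)} X(E/ℚ(ζ_{p^∞})) ∋ u · ∏_{i=0}^{p−2} L_p(E, ω^i, T)`.** As printed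
(Astérisque 295, Thm. 17.4, p. 273): "Assume `f` has good ordinary reduction at `λ`. Let `T` be a
`Gal(ℚ̄/ℚ)`-stable `O_λ`-lattice of `V_{F_λ}(f)`. (1) `X(T)` is a torsion `Λ`-module. […] (3) Let
`α, ω, γ` be as in (2), and assume that both `ω` and `γ` are good […] in the sense of 17.5 below.
Assume further `p ≠ 2` and that the condition 12.5.2 in 12.5 (4) is satisfied. Then
`L_{p-adic,α,ω,γ}(f)` belongs to `Λ` and `length_{Λ_𝔭}(X(T)_𝔭) ≤ ord_𝔭(L_{p-adic,α,ω,γ}(f))` for any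
prime ideal `𝔭` of `Λ` of height one" — with `Λ = O_λ⟦Gal(ℚ(ζ_{p^∞})/ℚ)⟧` (§12.1, §17.3), `X(T)`
the dual of `lim_n Sel(ℚ(ζ_{p^n}), T(r))(−r)` (§17.3) and (12.5.2) (p. 222) "the image of
`Gal(ℚ̄/ℚ(ζ_{p^∞})) → GL₂(O_λ)` contains `SL₂(ℤ_p)`". For `E/ℚ`, `p` odd, `T = T_pE(−1)`: the tower
`ℚ(ζ_{p^{n+1}})` is the cyclotomic `ℤ_p`-extension `K_∞` of `K = ℚ(ζ_p)`, so `X(T) = X(E/K_∞)` is the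
tree's Iwasawa module of (any `K`-model `V'` of) `E_K` for `κ : ZpExtension K p` cyclotomic,
`T = γ − 1`, `χ_p(γ) = 1 + p`; `Λ = ⊕_{i=0}^{p−2} Λ(Γ)e_i` (`#Δ = p − 1` prime to `p`) and the
printed inequality at every height-one prime says `char(e_iX) ∣ e_iL` in `Λ(Γ)` for every `i`,
whence `char_{Λ(Γ)} X(E/K_∞) ∋ ∏_i e_iL = ∏_i L_p(E,ω^i,T)`, the `p − 1` tame branches of the
Néron-normalised Mazur–Swinnerton-Dyer measure (Thm. 16.2 with `ω` Néron, `γ` good;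
Mazur–Tate–Teitelbaum 1986 §I.13: even branches on `[·]⁺`, odd branches on `[·]⁻`). In the tree's
normalisation by the newform periods (`ϖ·Ω_E = Ω⁺_f`, `ϖ'·|Ω⁻(E)| = Ω⁻_f`, one factor per branch
of the matching parity): `X(E/K_∞)` is `Λ`-torsion and
`u·ϖ^{(p−1)/2}ϖ'^{(p−1)/2}·∏_{i<p−1} B_i = ι g` for some `g ∈ char_Λ X(E/K_∞)` and a unit
`u ∈ ℤ_p^×`, where `B_i = padicLFunctionBranch f α i` (`i` even) or `padicLFunctionMinusBranch f α i`
(`i` odd), `α = unitRoot V p`, `ι = iwasawaToPowerSeries p`. (12.5.2) is transcribed by the stronger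
"`ρ̄_{E,p^n}` surjective for all `n`" (as in the tree's `kato_divisibility`, clause 3). The `p = 3`
instance is the sibling `charIdeal_dvd_padicLFunction_cyclotomicThree_of_surjective`
(`padicLFunctionBranch_zero`); same module shape and conclusion as the reducible sibling
`Wuthrich2014.charIdeal_dvd_padicLFunction_cyclotomicPrime`; named fact, nothing asserted.
[cite: Kato2004Asterisque, Thm. 17.4 (3) (p. 273) with §17.3 (p. 273), Thm. 12.5 (4) (12.5.2) (p. 222), §17.5 (p. 274), Thm. 16.2 (p. 269), §12.1 (p. 219)]
[cite: MazurTateTeitelbaum1986Invent, §I.13] -/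
def charIdeal_dvd_padicLFunction_cyclotomicPrime_of_surjective : Prop :=
  ∀ (p : ℕ) [Fact p.Prime] (V : WeierstrassCurve ℚ) [V.IsElliptic] [V.IsGloballyMinimal]
    (K : Type) [Field K] [NumberField K] [IsCyclotomicExtension {p} ℚ K]
    (V' : WeierstrassCurve K) [V'.IsElliptic]
    {κ : ZpExtension K p} {γ : Field.absoluteGaloisGroup K} {N : ℕ} [NeZero N]
    {f : CuspForm (Gamma0 N) 2},
    p ≠ 2 → IsOrdinaryAt V p → (∀ n : ℕ, V.HasSurjectiveModNGaloisRep (p ^ n : ℕ)) →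
    (∃ C : VariableChange K, C • V.baseChange K = V') →
    κ.IsCyclotomic → κ.IsTopGenerator γ →
    (∃ ζ : ℤ_[p]ˣ, IsOfFinOrder ζ ∧
      ((GaloisRep.cyclotomicCharacter K p γ * ζ : ℤ_[p]ˣ) : ℤ_[p]) =
        (cyclotomicGenerator p : ℤ_[p])) →
    IsNewformOf V f →
    ∀ (D : V'.SelmerDualData κ γ) (ϖ ϖ' : ℚ),
      (ϖ : ℝ) * V.realPeriodRat = plusPeriod f →
      (ϖ' : ℝ) * V.imaginaryPeriodRat = minusPeriod f →
      D.IsTorsion ∧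
      ∃ g ∈ D.charIdeal, ∃ u : ℤ_[p]ˣ,
        iwasawaToPowerSeries p g =
          PowerSeries.C (((u : ℤ_[p]) : ℚ_[p]) * (ϖ : ℚ_[p]) ^ (p / 2) * (ϖ' : ℚ_[p]) ^ (p / 2)) *
            ∏ i ∈ Finset.range (p - 1),
              (if Even i then padicLFunctionBranch f ((unitRoot V p : ℤ_[p]) : ℚ_[p]) i
                else padicLFunctionMinusBranch f ((unitRoot V p : ℤ_[p]) : ℚ_[p]) i)

end Literature.NumberTheory.EllipticCurves.Kato2004

end
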